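import Summits.CriticalPhenomena.PercolationContinuityZ3.Theorems.PercNearOneGluingNoHeavyLowerTailFourPointExchangeB
import Summits.CriticalPhenomena.PercolationContinuityZ3.Theorems.PercNearOneGluingNoHeavyLowerTailSwitchRelaxFinc24Measure
import Summits.CriticalPhenomena.PercolationContinuityZ3.Theorems.PercNearOneGluingNoHeavyLowerTailFourPointRelabelExchange
import Summits.CriticalPhenomena.PercolationContinuityZ3.Theorems.PercNearOneGluingNoHeavyLowerTailNineTypeKernelsAll
import Literature.Probability.Percolation.StrongHarrisThreePoint
import HarnessLib

/-!
# The pendant-`a` form of Conjecture W, up to three monomials (all `n`)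

Support file for crux `stmt-CriticalPhenomena-4575` (master-family programme; row `Q44` = Conjecture W of `prim-bnk-1`,
`TwoCopyMono.kerQ44`, open for all `n`), seat `prim-l12-p6` gen 26; memo
`run/shared/lean/prim/prim-l12/FROM-prim-l12-p6-g26-W-CENSUS-PENDANT-GRAM.md` §3, §5.  Cells `cell w a b c y i` of
`FourPointAtoms.pat4` (`0 a|b|c|y, 1 a|b|cy, 2 a|by|c, 3 a|bc|y, 4 ay|b|c, 5 ac|b|y, 6 ab|c|y, 7 a|bcy, 8 ay|bc, 9 ac|by, 10 acy|b,
11 ab|cy, 12 aby|c, 13 abc|y, 14 abcy`).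

**The pendant form.**  If a new terminal `a'` is attached to an arbitrary vertex `a` of a weighted graph by one pair of weight `t`
(and `a'` carries no other pair of positive weight), the one-bond pencil of Conjecture W for the quadruple `(a', b, c, y)` reads
`2·Q44 = t(1−t)·P_a + t²·(2·Q44 of (a,b,c,y))` with the quadratic form, in the cells of `(a,b,c,y)`,
`P_a = 2(c₁₁+c₁₄)(c₀+c₄+c₅+c₆) − 2(c₁+c₁₀+c₁₁)(c₆+c₈) − (c₂+c₉+c₁₂)(c₁₀+c₁₃) − (c₁+c₁₀+c₁₁)(c₁₂+c₁₃) − (c₇+c₁₄)(c₅+c₆)`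
(memo §3; for `a = b` it is the margin of Gladkov's three-point strong Harris–Kleitman inequality).  So `P_a ≥ 0` on every finite
weighted graph is NECESSARY for Conjecture W; it has an exact pseudo-law relative to the law-level dictionary of the memo (Harris, BHK
2006 Thms 1.1/2.1 with sets, Gladkov's sunflower rows, the kernel rows `Q44b`/SS7 and the single-product atlas with all relabelings,
complementary pairs; kit j207719), and its degree-2 shortfall over that dictionary is exactly the three monomials `c₀c₇ + c₀c₁₄ + c₁₀c₁₂`
(kit j207520/j207721).  PROVED HERE, for every finite weighted graph on `Fin n` and all marked points:

`Q44PendantA.pendantForm_upToThree_cells :`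
`2(c₁+c₁₀+c₁₁)(c₆+c₈) + (c₂+c₉+c₁₂)(c₁₀+c₁₃) + (c₁+c₁₀+c₁₁)(c₁₂+c₁₃) + (c₇+c₁₄)(c₅+c₆) ≤ 2(c₁₁+c₁₄)(c₀+c₄+c₅+c₆) + c₀c₇ + c₀c₁₄ + c₁₀c₁₂`.

Certificate (exact, verified symbolically): `P_a + c₀c₇ + c₀c₁₄ + c₁₀c₁₂ = SK3(b,c,y) + [c₄c₇ − c₁c₈] + [c₄c₁₄ − c₈c₁₀] + 2·Q44b + R`, with
`SK3(b,c,y)` = Gladkov's Cor. 4.2 for the triple `(b,c,y)` written in four-point cells (`sk3_bcy_cells`, from the tree's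
`prodBernoulli_threePoint_strongHarris`), `c₁c₈ ≤ c₄c₇` = `Q44TopGood.exch_c1c8_le_c4c7` (BHK two-set exchange), `c₈c₁₀ ≤ c₄c₁₄` =
the type-G exchange row of `prim-bnk-1` on the relabelled quadruple `(b,c,y,a)` (`exch_c8c10_le_c4c14`, via `typeG_cell'` and
the relabelling dictionary of `Q44TopGood.hasPattern_atom_perm`), `Q44b` = `TwoCopyMono.q44b_pack_nine`, and
`R = c₁c₂ + c₁c₃ + c₁c₉ + c₂c₃ + c₂c₈ + c₂c₁₁ + c₃c₉ + c₃c₁₀ + c₃c₁₁ + c₃c₁₂ + 2c₄c₁₁ + 2c₅c₁₁ + 2c₆c₈ + 2c₆c₉ + c₈c₉ + c₈c₁₁ + c₈c₁₂ + 3c₉c₁₁ ≥ 0`.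
No named facts, no sorries, no definitions; standard axioms.
-/

noncomputable section

namespace Summit.CriticalPhenomena.PercolationContinuityZ3.Theorems

namespace Q44PendantA

open MeasureTheory Set Literature.Probability.Percolation Literature.Probability.Percolation.BHK2006
open Literature.Probability.LatticeModels (prodBernoulli)
open DecisionTree (ind ind_of_mem ind_of_not_mem ind_nonneg)
open CondHarris FourPointAtoms FourPointExchange
open Summit.CriticalPhenomena.PercolationContinuityZ3.Cruxes.AdditiveGluing.TieLine.ConnAtoms
open scoped Classical

section generic

variable {V : Type*} [Fintype V] (w : Sym2 V → unitInterval) (a b c y : V)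

/-! ## Small helpers (as in `…FourPointExchangeEF`, whose olean the farm had not built when this file was written) -/

omit [Fintype V] in
/-- The indicator of an up-closed event is monotone. [folklore] -/
private theorem ind_monotone_of_upClosed' {E : Set (Set (Sym2 V))}
    (hE : ∀ ⦃ω ω' : Set (Sym2 V)⦄, ω ⊆ ω' → ω ∈ E → ω' ∈ E) : Monotone (ind E) := by
  intro ω ω' h
  by_cases hω : ω ∈ E
  · rw [ind_of_mem hω, ind_of_mem (hE h hω)]
  · rw [ind_of_not_mem hω]; exact ind_nonneg _ _

omit [Fintype V] in
/-- Reachability is monotone in the configuration. [folklore] -/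
private theorem reach_mono' {ω ω' : Set (Sym2 V)} (h : ω ⊆ ω') {x z : V} (hr : (openGraph ω).Reachable x z) :
    (openGraph ω').Reachable x z := SimpleGraph.Reachable.mono (openGraph_le h) hr

/-- Harris for two increasing events, measure form. [folklore] -/
private theorem harris_inc_inc' {E F : Set (Set (Sym2 V))} (hE : Monotone (ind E)) (hF : Monotone (ind F)) :
    (prodBernoulli w).real E * (prodBernoulli w).real F ≤ (prodBernoulli w).real (E ∩ F) := by
  have h := harris (wr_nonneg w) (wr_le_one w) (fun _ => ind_nonneg E _) (fun _ => ind_nonneg F _) hE hF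
  rw [sum_weight_wr w, one_mul] at h
  rw [measureReal_eq_sum, measureReal_eq_sum, measureReal_eq_sum]
  simpa only [BHK2006.ind_inter] using h

/-- Harris for an increasing and a decreasing event, measure form. [folklore] -/
private theorem harris_inc_dec' {E N : Set (Set (Sym2 V))} (hE : Monotone (ind E)) (hN : Antitone (ind N)) :
    (prodBernoulli w).real (E ∩ N) ≤ (prodBernoulli w).real E * (prodBernoulli w).real N := by
  have h := harris_mono_anti (wr_nonneg w) (wr_le_one w) (sum_weight_wr w) (fun _ => ind_nonneg E _) hE hN
    (fun _ => BHK2006.ind_le_one N _)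
  rw [measureReal_eq_sum, measureReal_eq_sum, measureReal_eq_sum]
  simpa only [BHK2006.ind_inter] using h

/-- **Type G exchange inequality** `μ(ab|cy)·μ(a|bcy) ≤ μ(a|b|cy)·μ(abcy)` (all marked points, every finite vertex type):
the conditional Harris inequality `P(a↔b | c↔y, c↮{a,b}) ≤ P(a↔b | c↮{a,b})` (`CondHarris.condHarris_cluster_mono_off_mono`
with source `c`, cluster function `1{y ∈ C_c}`, off-cluster event `{a↔b}`) and two Harris inequalities.  Statement and proof are
`FourPointExchange.typeG_cell` of seat `prim-bnk-1` gen 33 (proposal p371083, pending on farm oleans at the time of writing),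
re-derived verbatim here so that this file does not depend on a pending proposal. [adapted from prim-bnk-1 g33] -/
theorem typeG_cell' : cell w a b c y 11 * cell w a b c y 7 ≤ cell w a b c y 1 * cell w a b c y 14 := by
  have real_Dc_ab : (prodBernoulli w).real ((openConn c a)ᶜ ∩ (openConn c b)ᶜ) =
      cell w a b c y 0 + cell w a b c y 1 + cell w a b c y 2 + cell w a b c y 4 + cell w a b c y 6 + cell w a b c y 11 +
        cell w a b c y 12 := by
    rw [measureReal_eq_cellSum w a b c y (show HasPattern (quad a b c y) ((openConn c a)ᶜ ∩ (openConn c b)ᶜ) _ from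
      ((oc a b c y 2 0 rfl rfl).compl.inter (oc a b c y 2 1 rfl rfl).compl))]
    simp (config := {decide := true}) only [ite_true, ite_false]; ring
  have real_cy_ab_Dc : (prodBernoulli w).real (openConn c y ∩ openConn a b ∩ ((openConn c a)ᶜ ∩ (openConn c b)ᶜ)) =
      cell w a b c y 11 := by
    rw [measureReal_eq_cellSum w a b c y (show HasPattern (quad a b c y) (openConn c y ∩ openConn a b ∩ ((openConn c a)ᶜ ∩ (openConn c b)ᶜ)) _ from
      (((oc a b c y 2 3 rfl rfl).inter (oc a b c y 0 1 rfl rfl)).inter ((oc a b c y 2 0 rfl rfl).compl.inter (oc a b c y 2 1 rfl rfl).compl)))]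
    simp (config := {decide := true}) only [ite_true, ite_false]; ring
  have real_cy_Dc : (prodBernoulli w).real (openConn c y ∩ ((openConn c a)ᶜ ∩ (openConn c b)ᶜ)) = cell w a b c y 1 + cell w a b c y 11 := by
    rw [measureReal_eq_cellSum w a b c y (show HasPattern (quad a b c y) (openConn c y ∩ ((openConn c a)ᶜ ∩ (openConn c b)ᶜ)) _ from
      ((oc a b c y 2 3 rfl rfl).inter ((oc a b c y 2 0 rfl rfl).compl.inter (oc a b c y 2 1 rfl rfl).compl)))]
    simp (config := {decide := true}) only [ite_true, ite_false]; ring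
  have real_ab_Dc : (prodBernoulli w).real (openConn a b ∩ ((openConn c a)ᶜ ∩ (openConn c b)ᶜ)) =
      cell w a b c y 6 + cell w a b c y 11 + cell w a b c y 12 := by
    rw [measureReal_eq_cellSum w a b c y (show HasPattern (quad a b c y) (openConn a b ∩ ((openConn c a)ᶜ ∩ (openConn c b)ᶜ)) _ from
      ((oc a b c y 0 1 rfl rfl).inter ((oc a b c y 2 0 rfl rfl).compl.inter (oc a b c y 2 1 rfl rfl).compl)))]
    simp (config := {decide := true}) only [ite_true, ite_false]; ring
  have real_bcy : (prodBernoulli w).real (openConn b c ∩ openConn b y) = cell w a b c y 7 + cell w a b c y 14 := by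
    rw [measureReal_eq_cellSum w a b c y (show HasPattern (quad a b c y) (openConn b c ∩ openConn b y) _ from
      ((oc a b c y 1 2 rfl rfl).inter (oc a b c y 1 3 rfl rfl)))]
    simp (config := {decide := true}) only [ite_true, ite_false]; ring
  have real_ab_bcy : (prodBernoulli w).real (openConn a b ∩ (openConn b c ∩ openConn b y)) = cell w a b c y 14 := by
    rw [measureReal_eq_cellSum w a b c y (show HasPattern (quad a b c y) (openConn a b ∩ (openConn b c ∩ openConn b y)) _ from
      ((oc a b c y 0 1 rfl rfl).inter ((oc a b c y 1 2 rfl rfl).inter (oc a b c y 1 3 rfl rfl))))]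
    simp (config := {decide := true}) only [ite_true, ite_false]; ring
  have p0 := cell_nonneg w a b c y 0; have p1 := cell_nonneg w a b c y 1; have p2 := cell_nonneg w a b c y 2
  have p4 := cell_nonneg w a b c y 4; have p6 := cell_nonneg w a b c y 6; have p7 := cell_nonneg w a b c y 7
  have p11 := cell_nonneg w a b c y 11; have p12 := cell_nonneg w a b c y 12; have p13 := cell_nonneg w a b c y 13
  have p14 := cell_nonneg w a b c y 14
  by_cases hc : c ∈ ({a, b} : Set V)
  · have h := real_cy_ab_Dc
    rw [← Dis_two_eq, Dis_eq_empty hc, Set.inter_empty, measureReal_empty] at h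
    rw [← h, zero_mul]; exact mul_nonneg p1 p14
  have ha : a ∈ ({a, b} : Set V) := by simp
  have d := condHarris_cluster_mono_off_mono w c ({a, b} : Set V) hc (clusterFn_monotone c y) (ind_openConn_monotone a b)
    (ind_openConn_off ha)
  simp only [← ind_openConn_eq_clusterFn] at d
  rw [← real_inter_Dis, ← real_inter_Dis, ← measureReal_eq_sum, ← real_inter_inter_Dis, Dis_two_eq,
    real_Dc_ab, real_cy_ab_Dc, real_cy_Dc, real_ab_Dc] at d
  have hIab : Monotone (ind (openConn a b)) := ind_openConn_monotone a b
  have hND : Antitone (ind ((openConn c a)ᶜ ∩ (openConn c b)ᶜ)) := ind_compl_inter_antitone c a b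
  have hI2 : Monotone (ind (openConn b c ∩ openConn b y)) :=
    ind_monotone_of_upClosed' fun ω ω' h hω => ⟨reach_mono' h hω.1, reach_mono' h hω.2⟩
  have e1 := harris_inc_dec' w hIab hND
  have e2 := harris_inc_inc' w hIab hI2
  rw [real_ab_Dc, SwitchRelax.Finc24.rE2, real_Dc_ab] at e1
  rw [SwitchRelax.Finc24.rE2, real_bcy, real_ab_bcy] at e2
  set P := cell w a b c y 0 + cell w a b c y 1 + cell w a b c y 2 + cell w a b c y 4 + cell w a b c y 6 + cell w a b c y 11 +
    cell w a b c y 12 with hP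
  set Q := cell w a b c y 6 + cell w a b c y 11 + cell w a b c y 12 + cell w a b c y 13 + cell w a b c y 14 with hQ
  -- d : P · c11 ≤ (c1+c11)(c6+c11+c12);  e1 : c6+c11+c12 ≤ Q P;  e2 : Q (c7+c14) ≤ c14
  by_cases hc11 : cell w a b c y 11 = 0
  · rw [hc11, zero_mul]; exact mul_nonneg p1 p14
  have hPpos : 0 < P := by
    have : 0 < cell w a b c y 11 := lt_of_le_of_ne p11 (Ne.symm hc11)
    rw [hP]; linarith
  have key : P * (cell w a b c y 11 * (cell w a b c y 7 + cell w a b c y 14)) ≤ P * ((cell w a b c y 1 + cell w a b c y 11) * cell w a b c y 14) :=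
    calc P * (cell w a b c y 11 * (cell w a b c y 7 + cell w a b c y 14))
        = (P * cell w a b c y 11) * (cell w a b c y 7 + cell w a b c y 14) := by ring
      _ ≤ ((cell w a b c y 1 + cell w a b c y 11) * (cell w a b c y 6 + cell w a b c y 11 + cell w a b c y 12)) *
            (cell w a b c y 7 + cell w a b c y 14) := mul_le_mul_of_nonneg_right d (by positivity)
      _ ≤ ((cell w a b c y 1 + cell w a b c y 11) * (Q * P)) * (cell w a b c y 7 + cell w a b c y 14) :=
          mul_le_mul_of_nonneg_right (mul_le_mul_of_nonneg_left e1 (by positivity)) (by positivity)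
      _ = (cell w a b c y 1 + cell w a b c y 11) * P * (Q * (cell w a b c y 7 + cell w a b c y 14)) := by ring
      _ ≤ (cell w a b c y 1 + cell w a b c y 11) * P * cell w a b c y 14 := mul_le_mul_of_nonneg_left e2 (by positivity)
      _ = P * ((cell w a b c y 1 + cell w a b c y 11) * cell w a b c y 14) := by ring

  nlinarith [le_of_mul_le_mul_left key hPpos]

end generic

/-! ## The rows of the certificate in the cells of `(a,b,c,y)` on `Fin n` -/

variable {n : ℕ}

/-- Cells of the relabelled quadruple `(b c y a)` in the cells of `(a,b,c,y)` (the statement of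
`SingleSourceLaw.cell_relabel_bcya`, whose module the farm had not built when this file was written; re-derived from
`Q44TopGood.hasPattern_atom_perm`). [folklore] -/
private theorem cell_relabel_bcya' (w : Sym2 (Fin n) → unitInterval) (a b c y : Fin n) (i : Fin 15) :
    cell w b c y a i =
      (if (∀ j k : Fin 4, pat4 0 ((![1, 2, 3, 0] : Fin 4 → Fin 4) j) = pat4 0 ((![1, 2, 3, 0] : Fin 4 → Fin 4) k) ↔ pat4 i j = pat4 i k) then cell w a b c y 0 else 0) +
      (if (∀ j k : Fin 4, pat4 1 ((![1, 2, 3, 0] : Fin 4 → Fin 4) j) = pat4 1 ((![1, 2, 3, 0] : Fin 4 → Fin 4) k) ↔ pat4 i j = pat4 i k) then cell w a b c y 1 else 0) +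
      (if (∀ j k : Fin 4, pat4 2 ((![1, 2, 3, 0] : Fin 4 → Fin 4) j) = pat4 2 ((![1, 2, 3, 0] : Fin 4 → Fin 4) k) ↔ pat4 i j = pat4 i k) then cell w a b c y 2 else 0) +
      (if (∀ j k : Fin 4, pat4 3 ((![1, 2, 3, 0] : Fin 4 → Fin 4) j) = pat4 3 ((![1, 2, 3, 0] : Fin 4 → Fin 4) k) ↔ pat4 i j = pat4 i k) then cell w a b c y 3 else 0) +
      (if (∀ j k : Fin 4, pat4 4 ((![1, 2, 3, 0] : Fin 4 → Fin 4) j) = pat4 4 ((![1, 2, 3, 0] : Fin 4 → Fin 4) k) ↔ pat4 i j = pat4 i k) then cell w a b c y 4 else 0) +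
      (if (∀ j k : Fin 4, pat4 5 ((![1, 2, 3, 0] : Fin 4 → Fin 4) j) = pat4 5 ((![1, 2, 3, 0] : Fin 4 → Fin 4) k) ↔ pat4 i j = pat4 i k) then cell w a b c y 5 else 0) +
      (if (∀ j k : Fin 4, pat4 6 ((![1, 2, 3, 0] : Fin 4 → Fin 4) j) = pat4 6 ((![1, 2, 3, 0] : Fin 4 → Fin 4) k) ↔ pat4 i j = pat4 i k) then cell w a b c y 6 else 0) +
      (if (∀ j k : Fin 4, pat4 7 ((![1, 2, 3, 0] : Fin 4 → Fin 4) j) = pat4 7 ((![1, 2, 3, 0] : Fin 4 → Fin 4) k) ↔ pat4 i j = pat4 i k) then cell w a b c y 7 else 0) +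
      (if (∀ j k : Fin 4, pat4 8 ((![1, 2, 3, 0] : Fin 4 → Fin 4) j) = pat4 8 ((![1, 2, 3, 0] : Fin 4 → Fin 4) k) ↔ pat4 i j = pat4 i k) then cell w a b c y 8 else 0) +
      (if (∀ j k : Fin 4, pat4 9 ((![1, 2, 3, 0] : Fin 4 → Fin 4) j) = pat4 9 ((![1, 2, 3, 0] : Fin 4 → Fin 4) k) ↔ pat4 i j = pat4 i k) then cell w a b c y 9 else 0) +
      (if (∀ j k : Fin 4, pat4 10 ((![1, 2, 3, 0] : Fin 4 → Fin 4) j) = pat4 10 ((![1, 2, 3, 0] : Fin 4 → Fin 4) k) ↔ pat4 i j = pat4 i k) then cell w a b c y 10 else 0) +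
      (if (∀ j k : Fin 4, pat4 11 ((![1, 2, 3, 0] : Fin 4 → Fin 4) j) = pat4 11 ((![1, 2, 3, 0] : Fin 4 → Fin 4) k) ↔ pat4 i j = pat4 i k) then cell w a b c y 11 else 0) +
      (if (∀ j k : Fin 4, pat4 12 ((![1, 2, 3, 0] : Fin 4 → Fin 4) j) = pat4 12 ((![1, 2, 3, 0] : Fin 4 → Fin 4) k) ↔ pat4 i j = pat4 i k) then cell w a b c y 12 else 0) +
      (if (∀ j k : Fin 4, pat4 13 ((![1, 2, 3, 0] : Fin 4 → Fin 4) j) = pat4 13 ((![1, 2, 3, 0] : Fin 4 → Fin 4) k) ↔ pat4 i j = pat4 i k) then cell w a b c y 13 else 0) +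
      (if (∀ j k : Fin 4, pat4 14 ((![1, 2, 3, 0] : Fin 4 → Fin 4) j) = pat4 14 ((![1, 2, 3, 0] : Fin 4 → Fin 4) k) ↔ pat4 i j = pat4 i k) then cell w a b c y 14 else 0) := by
  unfold cell; rw [measureReal_eq_cellSum w a b c y (Q44TopGood.hasPattern_atom_perm (![1, 2, 3, 0] : Fin 4 → Fin 4) a b c y (q' := quad b c y a)
    (by intro j; fin_cases j <;> rfl) (pat4 i))]; rfl

/-- **Type G on the quadruple `(b,c,y,a)`**: `c₈·c₁₀ ≤ c₄·c₁₄`, i.e. `μ(ay|bc)·μ(acy|b) ≤ μ(ay|b|c)·μ(abcy)`. [this work] -/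
theorem exch_c8c10_le_c4c14 (w : Sym2 (Fin n) → unitInterval) (a b c y : Fin n) :
    cell w a b c y 8 * cell w a b c y 10 ≤ cell w a b c y 4 * cell w a b c y 14 := by
  have h := typeG_cell' w b c y a
  rw [cell_relabel_bcya' w a b c y 11, cell_relabel_bcya' w a b c y 7, cell_relabel_bcya' w a b c y 1,
    cell_relabel_bcya' w a b c y 14] at h
  simp (config := {decide := true}) only [ite_true, ite_false, zero_add, add_zero] at h
  linarith

/-- **Gladkov's three-point strong Harris–Kleitman inequality for the triple `(b,c,y)`, in four-point cells**:
`[P(bc|y)P(by|c) + P(bc|y)P(b|cy) + P(by|c)P(b|cy)] ≤ P(bcy)·P(b|c|y)` with `P(bc|y) = c₃+c₈+c₁₃`, `P(by|c) = c₂+c₉+c₁₂`,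
`P(b|cy) = c₁+c₁₀+c₁₁`, `P(bcy) = c₇+c₁₄`, `P(b|c|y) = c₀+c₄+c₅+c₆`. [cite: Gladkov2024StrongFKG, Cor. 4.2] -/
theorem sk3_bcy_cells (w : Sym2 (Fin n) → unitInterval) (a b c y : Fin n) :
    (cell w a b c y 3 + cell w a b c y 8 + cell w a b c y 13) * (cell w a b c y 2 + cell w a b c y 9 + cell w a b c y 12) +
        (cell w a b c y 3 + cell w a b c y 8 + cell w a b c y 13) * (cell w a b c y 1 + cell w a b c y 10 + cell w a b c y 11) +
        (cell w a b c y 2 + cell w a b c y 9 + cell w a b c y 12) * (cell w a b c y 1 + cell w a b c y 10 + cell w a b c y 11) ≤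
      (cell w a b c y 7 + cell w a b c y 14) * (cell w a b c y 0 + cell w a b c y 4 + cell w a b c y 5 + cell w a b c y 6) := by
  have h := prodBernoulli_threePoint_strongHarris w b c y
  have e1 : (prodBernoulli w).real (openConn b c ∩ (openConn b y)ᶜ) = cell w a b c y 3 + cell w a b c y 8 + cell w a b c y 13 := by
    rw [measureReal_eq_cellSum w a b c y (show HasPattern (quad a b c y) (openConn b c ∩ (openConn b y)ᶜ) _ from
      ((oc a b c y 1 2 rfl rfl).inter (oc a b c y 1 3 rfl rfl).compl))]
    simp (config := {decide := true}) only [ite_true, ite_false]; ring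
  have e2 : (prodBernoulli w).real (openConn b y ∩ (openConn b c)ᶜ) = cell w a b c y 2 + cell w a b c y 9 + cell w a b c y 12 := by
    rw [measureReal_eq_cellSum w a b c y (show HasPattern (quad a b c y) (openConn b y ∩ (openConn b c)ᶜ) _ from
      ((oc a b c y 1 3 rfl rfl).inter (oc a b c y 1 2 rfl rfl).compl))]
    simp (config := {decide := true}) only [ite_true, ite_false]; ring
  have e3 : (prodBernoulli w).real (openConn c y ∩ (openConn b c)ᶜ) = cell w a b c y 1 + cell w a b c y 10 + cell w a b c y 11 := by
    rw [measureReal_eq_cellSum w a b c y (show HasPattern (quad a b c y) (openConn c y ∩ (openConn b c)ᶜ) _ from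
      ((oc a b c y 2 3 rfl rfl).inter (oc a b c y 1 2 rfl rfl).compl))]
    simp (config := {decide := true}) only [ite_true, ite_false]; ring
  have e4 : (prodBernoulli w).real (openConn b c ∩ openConn b y) = cell w a b c y 7 + cell w a b c y 14 := by
    rw [measureReal_eq_cellSum w a b c y (show HasPattern (quad a b c y) (openConn b c ∩ openConn b y) _ from
      ((oc a b c y 1 2 rfl rfl).inter (oc a b c y 1 3 rfl rfl)))]
    simp (config := {decide := true}) only [ite_true, ite_false]; ring
  have e5 : (prodBernoulli w).real ((openConn b c)ᶜ ∩ (openConn b y)ᶜ ∩ (openConn c y)ᶜ) =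
      cell w a b c y 0 + cell w a b c y 4 + cell w a b c y 5 + cell w a b c y 6 := by
    rw [measureReal_eq_cellSum w a b c y (show HasPattern (quad a b c y) ((openConn b c)ᶜ ∩ (openConn b y)ᶜ ∩ (openConn c y)ᶜ) _ from
      (((oc a b c y 1 2 rfl rfl).compl.inter (oc a b c y 1 3 rfl rfl).compl).inter (oc a b c y 2 3 rfl rfl).compl))]
    simp (config := {decide := true}) only [ite_true, ite_false]; ring
  rw [e1, e2, e3, e4, e5] at h
  exact h

/-- **The pendant-`a` form of Conjecture W up to three monomials** (all `n`, all marked points):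
`2(c₁+c₁₀+c₁₁)(c₆+c₈) + (c₂+c₉+c₁₂)(c₁₀+c₁₃) + (c₁+c₁₀+c₁₁)(c₁₂+c₁₃) + (c₇+c₁₄)(c₅+c₆) ≤ 2(c₁₁+c₁₄)(c₀+c₄+c₅+c₆) + c₀c₇ + c₀c₁₄ + c₁₀c₁₂`
— the necessary 4-point consequence `P_a ≥ 0` of Conjecture W holds up to the three products `P(∅)P(a|bcy) + P(∅)P(abcy) + P(acy|b)P(aby|c)`
(the exact degree-2 shortfall of `P_a` over the memo's law-level dictionary). [this work] -/
theorem pendantForm_upToThree_cells (w : Sym2 (Fin n) → unitInterval) (a b c y : Fin n) :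
    2 * ((cell w a b c y 1 + cell w a b c y 10 + cell w a b c y 11) * (cell w a b c y 6 + cell w a b c y 8)) +
          (cell w a b c y 2 + cell w a b c y 9 + cell w a b c y 12) * (cell w a b c y 10 + cell w a b c y 13) +
          (cell w a b c y 1 + cell w a b c y 10 + cell w a b c y 11) * (cell w a b c y 12 + cell w a b c y 13) +
          (cell w a b c y 7 + cell w a b c y 14) * (cell w a b c y 5 + cell w a b c y 6) ≤
      2 * ((cell w a b c y 11 + cell w a b c y 14) * (cell w a b c y 0 + cell w a b c y 4 + cell w a b c y 5 + cell w a b c y 6)) +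
        cell w a b c y 0 * cell w a b c y 7 + cell w a b c y 0 * cell w a b c y 14 + cell w a b c y 10 * cell w a b c y 12 := by
  have hS := sk3_bcy_cells w a b c y
  have hD := Q44TopGood.exch_c1c8_le_c4c7 w a b c y
  have hG := exch_c8c10_le_c4c14 w a b c y
  have hQ := TwoCopyMono.q44b_pack_nine w a b c y
  have r12 := mul_nonneg (cell_nonneg w a b c y 1) (cell_nonneg w a b c y 2)
  have r13 := mul_nonneg (cell_nonneg w a b c y 1) (cell_nonneg w a b c y 3)
  have r19 := mul_nonneg (cell_nonneg w a b c y 1) (cell_nonneg w a b c y 9)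
  have r23 := mul_nonneg (cell_nonneg w a b c y 2) (cell_nonneg w a b c y 3)
  have r28 := mul_nonneg (cell_nonneg w a b c y 2) (cell_nonneg w a b c y 8)
  have r211 := mul_nonneg (cell_nonneg w a b c y 2) (cell_nonneg w a b c y 11)
  have r39 := mul_nonneg (cell_nonneg w a b c y 3) (cell_nonneg w a b c y 9)
  have r310 := mul_nonneg (cell_nonneg w a b c y 3) (cell_nonneg w a b c y 10)
  have r311 := mul_nonneg (cell_nonneg w a b c y 3) (cell_nonneg w a b c y 11)
  have r312 := mul_nonneg (cell_nonneg w a b c y 3) (cell_nonneg w a b c y 12)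
  have r411 := mul_nonneg (cell_nonneg w a b c y 4) (cell_nonneg w a b c y 11)
  have r511 := mul_nonneg (cell_nonneg w a b c y 5) (cell_nonneg w a b c y 11)
  have r68 := mul_nonneg (cell_nonneg w a b c y 6) (cell_nonneg w a b c y 8)
  have r69 := mul_nonneg (cell_nonneg w a b c y 6) (cell_nonneg w a b c y 9)
  have r89 := mul_nonneg (cell_nonneg w a b c y 8) (cell_nonneg w a b c y 9)
  have r811 := mul_nonneg (cell_nonneg w a b c y 8) (cell_nonneg w a b c y 11)
  have r812 := mul_nonneg (cell_nonneg w a b c y 8) (cell_nonneg w a b c y 12)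
  have r911 := mul_nonneg (cell_nonneg w a b c y 9) (cell_nonneg w a b c y 11)
  linear_combination hS + hD + hG + 2 * hQ + r12 + r13 + r19 + r23 + r28 + r211 + r39 + r310 + r311 + r312 + 2 * r411 +
    2 * r511 + 2 * r68 + 2 * r69 + r89 + r811 + r812 + 3 * r911

end Q44PendantA

end Summit.CriticalPhenomena.PercolationContinuityZ3.Theorems
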